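import Summits.AtomisticToContinuum.Crystallization.Theorems.FrustratedLawDichotomyStrainedPatchTaylorCap
import Summits.AtomisticToContinuum.Crystallization.Theorems.FrustratedLawDichotomyStrainedPatchRecutBuild
import Summits.AtomisticToContinuum.Crystallization.Theorems.FrustratedLawDichotomyStrainedPatchHomLatticeBoxHcp

/-!
# Lattice kit for the instance rim mass: bent fcc / hcp balls have `≥ 14` sites within `9/5` of every rim site (lens-5 g53, crux 27623 T-side, node T2-bent₁)

`…TaylorCap` reduced (T2-bent₁) to the instance-only rim-mass bound `InstanceRimMassLe (38/3)`:
`Σ_{b ∈ instRim(z₁, c₁)} 1/#B_{z₁}(b) ≤ 38/3` for every comparison instance `(z₁, c₁) ∈ 𝓘₁⁺ = CompFamily1`.  An instance is a BENT HOMOGENEOUS BALL: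
`z₁ a − z₁ c₁ = b (z₀ a − z₀ c₁)` with `b ∈ 𝓑₁ = polyBends (11/2000) (11/20000)` (`b v = v + Q v v + C v v v`) and `z₀` an fcc or hcp lattice ball of
radius `133/10` through `G`, `‖G − 1‖ ≤ 1/4` (hcp: second family shifted by `G (hcpShift + ξ)`, `‖ξ‖ ≤ 1/4`).  This file supplies the counting kit and the
fcc half of ★★ `#B_{z₁}(b) ≥ 14` for rim sites `b` (`7/4 < |z₁ b − z₁ c₁| ≤ 9/5`); `…TaylorClose` does the hcp half and closes (T2-bent₁).
§1 bend kit: `polyBend_chord` — `‖b x − b y − (x − y)‖ ≤ (q₂(‖x‖+‖y‖) + q₃(‖x‖²+‖x‖‖y‖+‖y‖²))‖x − y‖` (bilinear/trilinear telescoping), hence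
`bend_dist_le` (`11/10`-Lipschitz on `‖·‖ ≤ 4`) and `norm_le_of_bend_le` (`‖y‖ ≤ 133/10`, `‖b y‖ ≤ 9/5 ⟹ ‖y‖ ≤ 11/5`).
§2 lattice kit: `‖G w‖ ≤ (5/4)‖w‖`; the twelve fcc nearest-neighbour labels `nnFcc` (`‖fccPoint m‖ = 1`).
§3 ★★ `fourteen_le_card_ball_fcc`: the labels `{a_b} ∪ {0} ∪ (a_b + nnFcc)` give `14` distinct sites (`latPt_fcc_injective`) in the range of `z₀`
(norms `≤ 11/5 + 5/4 ≤ 133/10`) whose bent images lie within `(11/10)·(5/4) < 9/5` of `z₁ b` (the centre by symmetry of `dist`); `a_b ∉ −nnFcc` and `a_b ≠ 0`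
because `|z₁ b − z₁ c₁| > 7/4 > (11/10)(5/4)`.
§4 hcp kit: label plumbing `card_le_card_ball_of_labels` (`Function.invFun z₀`), the label sets `nnHex` (in-layer, `‖P m‖ = 1`), `nnShift` / `nnShiftNeg`
(`‖P m + hcpShift‖ = 1`, `‖P (−m) + hcpShift‖ = 1`), positions `hcpPos G ξ (β, a) = latPt G hexFrame a [+ G (hcpShift + ξ)]` (injective: `latPt_hex_injective`,
`shifted_ne_unshifted`), neighbour labels `hcpNbrs` (`#= 12`) and ★ `norm_hcpPos_sub_le`: neighbour offsets have norm `≤ (5/4)(1 + 1/4) = 25/16`.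
-/

open scoped BigOperators Classical
open Summit.AtomisticToContinuum.Crystallization.Theorems.FrustratedLawDichotomyRangeCut (Sep)
open Summit.AtomisticToContinuum.Crystallization.Theorems.FrustratedLawDichotomyMotifLemmas
open Summit.AtomisticToContinuum.Crystallization.Theorems.FrustratedLawDichotomyAveragingCut
open Summit.AtomisticToContinuum.Crystallization.Theorems.FrustratedLawDichotomyAveragingRuleCap
open Summit.AtomisticToContinuum.Crystallization.Theorems.FrustratedLawDichotomyAveragingRuleTightFree
open Summit.AtomisticToContinuum.Crystallization.Theorems.FrustratedLawDichotomyExemptAbsorptionRecord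
open Summit.AtomisticToContinuum.Crystallization.Theorems.FrustratedLawDichotomySchurCut
open Literature.MathematicalPhysics.StatisticalMechanics (lennardJones lennardJones_nonpos)
open Summit.AtomisticToContinuum.Crystallization.Theorems.FrustratedLawDichotomyRuleToolkitGood
open Summit.AtomisticToContinuum.Crystallization.Theorems.FrustratedLawDichotomyStrainedPatchHomSplit
open Summit.AtomisticToContinuum.Crystallization.Theorems.FrustratedLawDichotomyStrainedPatchHomTermCalculus
open Summit.AtomisticToContinuum.Crystallization.Theorems.FrustratedLawDichotomyStrainedPatchChartFamilies
open Summit.AtomisticToContinuum.Crystallization.Theorems.FrustratedLawDichotomyStrainedPatchChartFamiliesBent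
open Summit.AtomisticToContinuum.Crystallization.Theorems.FrustratedLawDichotomyStrainedPatchChartFamiliesPinned
open Summit.AtomisticToContinuum.Crystallization.Theorems.FrustratedLawDichotomyStrainedPatchEnvelopeLaw
open Summit.AtomisticToContinuum.Crystallization.Theorems.FrustratedLawDichotomyStrainedPatchEnvelopeTaylor

open Summit.AtomisticToContinuum.Crystallization.Theorems.FrustratedLawDichotomyStrainedPatchTaylorSplit
open Summit.AtomisticToContinuum.Crystallization.Theorems.FrustratedLawDichotomyStrainedPatchRecutBuild (polyBend_zero)
open Summit.AtomisticToContinuum.Crystallization.Theorems.FrustratedLawDichotomyStrainedPatchTaylorPair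
open Summit.AtomisticToContinuum.Crystallization.Theorems.FrustratedLawDichotomyStrainedPatchTaylorChord

open Summit.AtomisticToContinuum.Crystallization.Theorems.FrustratedLawDichotomyStrainedPatchTaylorLeaves

open Summit.AtomisticToContinuum.Crystallization.Theorems.FrustratedLawDichotomyStrainedPatchTaylorRegular
open Summit.AtomisticToContinuum.Crystallization.Theorems.FrustratedLawDichotomyStrainedPatchTaylorKbandKit
open Summit.AtomisticToContinuum.Crystallization.Theorems.FrustratedLawDichotomyStrainedPatchTaylorKband
open Summit.AtomisticToContinuum.Crystallization.Theorems.FrustratedLawDichotomyStrainedPatchTaylorTail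
open Summit.AtomisticToContinuum.Crystallization.Theorems.FrustratedLawDichotomyStrainedPatchTaylorKband
open Summit.AtomisticToContinuum.Crystallization.Theorems.FrustratedLawDichotomyStrainedPatchTaylorTail
open Summit.AtomisticToContinuum.Crystallization.Theorems.FrustratedLawDichotomyStrainedPatchTaylorCap
open Literature.Barriers.AtomisticToContinuum.FlatleyTheil2015 (fccVec fccPoint norm_fccPoint_sq fccPoint_injective)
open Summit.AtomisticToContinuum.Crystallization.Theorems.FrustratedLawDichotomyStrainedPatchHomLattice (latPt_add latPt_sub latPt_neg)
open Summit.AtomisticToContinuum.Crystallization.Theorems.FrustratedLawDichotomyStrainedPatchHomRelief (latPt_fccVec_eq)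
open Summit.AtomisticToContinuum.Crystallization.Theorems.FrustratedLawDichotomyStrainedPatchHomLatticeBox
open Summit.AtomisticToContinuum.Crystallization.Theorems.FrustratedLawDichotomyStrainedPatchHomLatticeBoxHcp

namespace Summit.AtomisticToContinuum.Crystallization.Theorems.FrustratedLawDichotomyStrainedPatchTaylorLattice

/-! ## §1. Bend kit: polynomial bends are near-isometries near the centre -/

-- `polyBend_zero` is landed in `…StrainedPatchRecutBuild` (gate dedup); imported and opened from there.

/-- ★ CHORD CONTROL: `‖b x − b y − (x − y)‖ ≤ (q₂(‖x‖ + ‖y‖) + q₃(‖x‖² + ‖x‖‖y‖ + ‖y‖²))·‖x − y‖` (bilinear / trilinear telescoping). [folklore] -/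
theorem polyBend_chord {q₂ q₃ : ℝ} {b : E3 → E3} (hb : b ∈ polyBends q₂ q₃) (x y : E3) :
    ‖b x - b y - (x - y)‖ ≤ (q₂ * (‖x‖ + ‖y‖) + q₃ * (‖x‖ ^ 2 + ‖x‖ * ‖y‖ + ‖y‖ ^ 2)) * ‖x - y‖ := by
  obtain ⟨Q, C, hQ, hC, hbv⟩ := hb
  have e : b x - b y - (x - y) = (Q x (x - y) + Q (x - y) y) + (C x x (x - y) + C x (x - y) y + C (x - y) y y) := by
    rw [hbv x, hbv y]; simp only [map_sub, LinearMap.sub_apply]; abel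
  have h1 := hQ x (x - y)
  have h2 := hQ (x - y) y
  have h3 := hC x x (x - y)
  have h4 := hC x (x - y) y
  have h5 := hC (x - y) y y
  have htri : ‖b x - b y - (x - y)‖ ≤ ‖Q x (x - y)‖ + ‖Q (x - y) y‖ + (‖C x x (x - y)‖ + ‖C x (x - y) y‖ + ‖C (x - y) y y‖) := by
    rw [e]
    refine (norm_add_le _ _).trans (add_le_add (norm_add_le _ _) ?_)
    exact (norm_add_le _ _).trans (add_le_add (norm_add_le _ _) le_rfl)
  have hx := norm_nonneg x
  have hy := norm_nonneg y
  have hxy := norm_nonneg (x - y)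
  nlinarith

/-- Near the centre a bend of `𝓑₁ = polyBends (11/2000) (11/20000)` is `11/10`-Lipschitz: `‖x‖, ‖y‖ ≤ 4 → ‖b x − b y‖ ≤ (11/10)‖x − y‖`. [folklore] -/
theorem bend_dist_le {b : E3 → E3} (hb : b ∈ bends1) {x y : E3} (hx : ‖x‖ ≤ 4) (hy : ‖y‖ ≤ 4) : ‖b x - b y‖ ≤ 11 / 10 * ‖x - y‖ := by
  have hc := polyBend_chord hb x y
  have htri : ‖b x - b y‖ ≤ ‖b x - b y - (x - y)‖ + ‖x - y‖ := by
    have := norm_add_le (b x - b y - (x - y)) (x - y); rwa [sub_add_cancel] at this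
  have h0 := norm_nonneg x
  have h1 := norm_nonneg y
  have h2 := norm_nonneg (x - y)
  have hfac : (11 / 2000 : ℝ) * (‖x‖ + ‖y‖) + 11 / 20000 * (‖x‖ ^ 2 + ‖x‖ * ‖y‖ + ‖y‖ ^ 2) ≤ 1 / 10 := by nlinarith
  nlinarith

/-- A `133/10`-ball vector whose bent image is within `9/5` of the centre has length `≤ 11/5`. [folklore] -/
theorem norm_le_of_bend_le {b : E3 → E3} (hb : b ∈ bends1) {y : E3} (hy : ‖y‖ ≤ 133 / 10) (hby : ‖b y‖ ≤ 9 / 5) : ‖y‖ ≤ 11 / 5 := by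
  have hc := polyBend_chord hb y 0
  rw [polyBend_zero hb, sub_zero, sub_zero, norm_zero] at hc
  have htri : ‖y‖ ≤ ‖b y‖ + ‖b y - y‖ := by
    have := norm_sub_le (b y) (b y - y); rwa [sub_sub_cancel] at this
  have h0 := norm_nonneg y
  set t := ‖y‖
  have ht2 : t * t ≤ 133 / 10 * t := by nlinarith
  have ht3 : t ^ 2 * t ≤ (133 / 10) ^ 2 * t := by nlinarith
  nlinarith

/-! ## §2. Lattice kit -/

/-- `‖G − 1‖ ≤ 1/4 ⟹ ‖G w‖ ≤ (5/4)‖w‖`. [folklore] -/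
theorem norm_apply_le_of_near_one {G : E3 →L[ℝ] E3} (hG : ‖G - 1‖ ≤ 1 / 4) (w : E3) : ‖G w‖ ≤ 5 / 4 * ‖w‖ := by
  have hdec : G w = w + (G - 1) w := by simp
  have hop : ‖(G - 1) w‖ ≤ 1 / 4 * ‖w‖ := ((G - 1).le_opNorm w).trans (mul_le_mul_of_nonneg_right hG (norm_nonneg _))
  rw [hdec]
  exact (norm_add_le _ _).trans (by linarith)

/-- The twelve nearest-neighbour labels of the fcc lattice in Flatley–Theil's basis (`±eᵢ`, `±(eᵢ − eⱼ)`). -/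
def nnFcc : Finset (Fin 3 → ℤ) :=
  {![1, 0, 0], ![-1, 0, 0], ![0, 1, 0], ![0, -1, 0], ![0, 0, 1], ![0, 0, -1],
   ![1, -1, 0], ![-1, 1, 0], ![1, 0, -1], ![-1, 0, 1], ![0, 1, -1], ![0, -1, 1]}

/-- `#nnFcc = 12`. [arithmetic] -/
theorem card_nnFcc : nnFcc.card = 12 := by decide

/-- `0 ∉ nnFcc`. [arithmetic] -/
theorem zero_not_mem_nnFcc : (0 : Fin 3 → ℤ) ∉ nnFcc := by decide

/-- The fcc nearest-neighbour vectors have length `1`. [folklore] -/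
theorem norm_fccPoint_of_mem_nnFcc {m : Fin 3 → ℤ} (hm : m ∈ nnFcc) : ‖fccPoint m‖ = 1 := by
  have hsq : ‖fccPoint m‖ ^ 2 = 1 := by
    rw [norm_fccPoint_sq]
    simp only [nnFcc, Finset.mem_insert, Finset.mem_singleton] at hm
    rcases hm with rfl | rfl | rfl | rfl | rfl | rfl | rfl | rfl | rfl | rfl | rfl | rfl <;>
      simp [Matrix.cons_val_two, Matrix.tail_cons, Matrix.head_cons]
  have h0 := norm_nonneg (fccPoint m)
  nlinarith

/-! ## §3. fcc instances: a rim site has at least `14` instance sites within `9/5` -/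

/-- ★★ fcc instances: a site `b` with `7/4 < |z₁ b − z₁ c₁| ≤ 9/5` has `≥ 14` instance sites within `9/5`: itself, the centre, and its twelve bent
nearest neighbours (offsets `‖G fccPoint m‖ ≤ 5/4`, bent chords `≤ (11/10)·5/4 < 9/5`; all within `133/10` of the centre, hence sites). [folklore] -/
theorem fourteen_le_card_ball_fcc {M₁ : ℕ} {z₁ z₀ : Fin M₁ → E3} {c₁ : Fin M₁} {bm : E3 → E3} (hbm : bm ∈ bends1)
    (hz : ∀ a, z₁ a - z₁ c₁ = bm (z₀ a - z₀ c₁)) {G : E3 →L[ℝ] E3} (hG : ‖G - 1‖ ≤ 1 / 4)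
    (hrange : Set.range z₀ = {x | dist x (z₀ c₁) ≤ 133 / 10 ∧ ∃ a : Fin 3 → ℤ, x = z₀ c₁ + latPt G fccVec a})
    {b : Fin M₁} (hb1 : 7 / 4 < dist (z₁ b) (z₁ c₁)) (hb2 : dist (z₁ b) (z₁ c₁) ≤ 9 / 5) : 14 ≤ (ball (9 / 5) z₁ b).card := by
  classical
  have hbmem : z₀ b ∈ Set.range z₀ := ⟨b, rfl⟩
  rw [hrange] at hbmem
  obtain ⟨hbR, ab, hab⟩ := hbmem
  have hy0 : z₀ b - z₀ c₁ = latPt G fccVec ab := by rw [hab]; abel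
  have hyR : ‖latPt G fccVec ab‖ ≤ 133 / 10 := by rw [← hy0, ← dist_eq_norm]; exact hbR
  have hzb : z₁ b - z₁ c₁ = bm (latPt G fccVec ab) := by rw [hz b, hy0]
  have hby : ‖bm (latPt G fccVec ab)‖ ≤ 9 / 5 := by rw [← hzb, ← dist_eq_norm]; exact hb2
  have hby' : 7 / 4 < ‖bm (latPt G fccVec ab)‖ := by rw [← hzb, ← dist_eq_norm]; exact hb1
  have hy : ‖latPt G fccVec ab‖ ≤ 11 / 5 := norm_le_of_bend_le hbm hyR hby
  have hne : Nonempty (Fin M₁) := ⟨c₁⟩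
  let F : (Fin 3 → ℤ) → Fin M₁ := fun m => Function.invFun z₀ (z₀ c₁ + latPt G fccVec (ab + m))
  have hF : ∀ m : Fin 3 → ℤ, ‖latPt G fccVec (ab + m)‖ ≤ 133 / 10 → z₀ (F m) = z₀ c₁ + latPt G fccVec (ab + m) := by
    intro m hm
    have hmem : z₀ c₁ + latPt G fccVec (ab + m) ∈ Set.range z₀ := by
      rw [hrange]; exact ⟨by rw [dist_eq_norm, add_sub_cancel_left]; exact hm, ab + m, rfl⟩
    exact Function.invFun_eq hmem
  have hoff : ∀ m ∈ nnFcc, ‖latPt G fccVec m‖ ≤ 5 / 4 := by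
    intro m hm
    rw [latPt_fccVec_eq]
    have := norm_apply_le_of_near_one hG (fccPoint m)
    rw [norm_fccPoint_of_mem_nnFcc hm] at this
    linarith
  have hab0 : ab ≠ 0 := by
    intro h0
    rw [h0, latPt_zero, polyBend_zero hbm, norm_zero] at hby'
    norm_num at hby'
  have hnegab : -ab ∉ insert (0 : Fin 3 → ℤ) nnFcc := by
    rw [Finset.mem_insert, not_or]
    refine ⟨neg_ne_zero.2 hab0, fun hmem => ?_⟩
    have h1 : ‖latPt G fccVec ab‖ ≤ 5 / 4 := by
      have := hoff (-ab) hmem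
      rwa [latPt_neg, norm_neg] at this
    have h2 : ‖bm (latPt G fccVec ab) - bm 0‖ ≤ 11 / 10 * ‖latPt G fccVec ab - 0‖ :=
      bend_dist_le hbm (by linarith) (by rw [norm_zero]; norm_num)
    rw [polyBend_zero hbm, sub_zero, sub_zero] at h2
    linarith
  have hscard : (insert (-ab) (insert (0 : Fin 3 → ℤ) nnFcc)).card = 14 := by
    rw [Finset.card_insert_of_notMem hnegab, Finset.card_insert_of_notMem zero_not_mem_nnFcc, card_nnFcc]
  have hinR : ∀ m ∈ insert (-ab) (insert (0 : Fin 3 → ℤ) nnFcc), ‖latPt G fccVec (ab + m)‖ ≤ 133 / 10 := by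
    intro m hm
    rcases Finset.mem_insert.1 hm with rfl | hm'
    · rw [add_neg_cancel, latPt_zero, norm_zero]; norm_num
    rcases Finset.mem_insert.1 hm' with rfl | hm''
    · rw [add_zero]; linarith
    · rw [latPt_add]; exact (norm_add_le _ _).trans (by linarith [hoff m hm''])
  have hmaps : ∀ m ∈ insert (-ab) (insert (0 : Fin 3 → ℤ) nnFcc), F m ∈ ball (9 / 5) z₁ b := by
    intro m hm
    rw [mem_ball]
    have hzF : z₁ (F m) - z₁ c₁ = bm (latPt G fccVec (ab + m)) := by
      rw [hz (F m), hF m (hinR m hm), add_sub_cancel_left]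
    rcases Finset.mem_insert.1 hm with rfl | hm'
    · rw [add_neg_cancel, latPt_zero, polyBend_zero hbm, sub_eq_zero] at hzF
      rw [hzF, dist_comm]; exact hb2
    · have hm5 : ‖latPt G fccVec m‖ ≤ 5 / 4 := by
        rcases Finset.mem_insert.1 hm' with rfl | hm''
        · rw [latPt_zero, norm_zero]; norm_num
        · exact hoff m hm''
      have hx : ‖latPt G fccVec ab + latPt G fccVec m‖ ≤ 4 := (norm_add_le _ _).trans (by linarith)
      have hd : dist (z₁ (F m)) (z₁ b) = ‖bm (latPt G fccVec (ab + m)) - bm (latPt G fccVec ab)‖ := by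
        rw [dist_eq_norm, ← hzF, ← hzb]; congr 1; abel
      rw [hd, latPt_add]
      have := bend_dist_le hbm hx (by linarith : ‖latPt G fccVec ab‖ ≤ 4)
      rw [add_sub_cancel_left] at this
      linarith
  have hinj : Set.InjOn F ↑(insert (-ab) (insert (0 : Fin 3 → ℤ) nnFcc)) := by
    intro m hm m' hm' hFm
    have h1 := hF m (hinR m (Finset.mem_coe.1 hm))
    have h2 := hF m' (hinR m' (Finset.mem_coe.1 hm'))
    have h3 : z₀ c₁ + latPt G fccVec (ab + m) = z₀ c₁ + latPt G fccVec (ab + m') := by rw [← h1, ← h2, hFm]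
    exact add_left_cancel (latPt_fcc_injective hG (add_left_cancel h3))
  calc 14 = (insert (-ab) (insert (0 : Fin 3 → ℤ) nnFcc)).card := hscard.symm
    _ ≤ (ball (9 / 5) z₁ b).card := Finset.card_le_card_of_injOn F hmaps hinj

/-! ## §4. hcp instances -/

/-- Index plumbing: `#s` labelled lattice positions in the range of `z₀`, pairwise distinct, whose sites lie within `9/5` of `z₁ b`, give `#s` ball members.
[formal bookkeeping] -/
theorem card_le_card_ball_of_labels {M₁ : ℕ} {z₁ z₀ : Fin M₁ → E3} {b : Fin M₁} {ι : Type*} (s : Finset ι) (pos : ι → E3)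
    (hrange : ∀ L ∈ s, pos L ∈ Set.range z₀) (hinj : Set.InjOn pos ↑s)
    (hdist : ∀ L ∈ s, ∀ j : Fin M₁, z₀ j = pos L → dist (z₁ j) (z₁ b) ≤ 9 / 5) : s.card ≤ (ball (9 / 5) z₁ b).card := by
  classical
  have hne : Nonempty (Fin M₁) := ⟨b⟩
  have hF : ∀ L ∈ s, z₀ (Function.invFun z₀ (pos L)) = pos L := fun L hL => Function.invFun_eq (hrange L hL)
  refine Finset.card_le_card_of_injOn (fun L => Function.invFun z₀ (pos L)) (fun L hL => ?_) (fun L hL L' hL' h => ?_)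
  · exact mem_ball.2 (hdist L hL _ (hF L hL))
  · beta_reduce at h
    have h' : pos L = pos L' := by rw [← hF L (Finset.mem_coe.1 hL), ← hF L' (Finset.mem_coe.1 hL'), h]
    exact hinj hL hL' h'

/-- The six in-layer nearest-neighbour labels of the hexagonal layer lattice (`±e₁`, `±e₂`, `±(e₁ − e₂)`). -/
def nnHex : Finset (Fin 3 → ℤ) := {![1, 0, 0], ![-1, 0, 0], ![0, 1, 0], ![0, -1, 0], ![1, -1, 0], ![-1, 1, 0]}

/-- The six labels `m` with `‖P m + hcpShift‖ = 1` (the B-layer neighbours of an A-site: three above, three below). -/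
def nnShift : Finset (Fin 3 → ℤ) := {![0, 0, 0], ![-1, 0, 0], ![0, -1, 0], ![0, 0, -1], ![-1, 0, -1], ![0, -1, -1]}

/-- The negatives of `nnShift` (the A-layer neighbours of a B-site). -/
def nnShiftNeg : Finset (Fin 3 → ℤ) := {![0, 0, 0], ![1, 0, 0], ![0, 1, 0], ![0, 0, 1], ![1, 0, 1], ![0, 1, 1]}

/-- `#nnHex = 6`, `0 ∉ nnHex`, `#nnShift = #nnShiftNeg = 6`. [arithmetic] -/
theorem card_nn6 : nnHex.card = 6 ∧ (0 : Fin 3 → ℤ) ∉ nnHex ∧ nnShift.card = 6 ∧ nnShiftNeg.card = 6 := by decide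

/-- In-layer neighbours have length `1`: `m ∈ nnHex → ‖P m‖ = 1`. [arithmetic] -/
theorem norm_hexPt_of_mem_nnHex {m : Fin 3 → ℤ} (hm : m ∈ nnHex) : ‖latPt 1 hexFrame m‖ = 1 := by
  have hsq : ‖latPt 1 hexFrame m‖ ^ 2 = 1 := by
    rw [norm_sq_hexPt]
    simp only [nnHex, Finset.mem_insert, Finset.mem_singleton] at hm
    rcases hm with rfl | rfl | rfl | rfl | rfl | rfl <;> simp [Matrix.cons_val_two, Matrix.tail_cons, Matrix.head_cons]
  have h0 := norm_nonneg (latPt 1 hexFrame m)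
  nlinarith

/-- B-layer neighbours: `m ∈ nnShift → ‖P m + hcpShift‖ = 1`. [arithmetic] -/
theorem norm_hexPt_add_shift_of_mem_nnShift {m : Fin 3 → ℤ} (hm : m ∈ nnShift) : ‖latPt 1 hexFrame m + hcpShift‖ = 1 := by
  have hsq : ‖latPt 1 hexFrame m + hcpShift‖ ^ 2 = 1 := by
    rw [norm_sq_hexPt_add_shift]
    simp only [nnShift, Finset.mem_insert, Finset.mem_singleton] at hm
    rcases hm with rfl | rfl | rfl | rfl | rfl | rfl <;> simp [Matrix.cons_val_two, Matrix.tail_cons, Matrix.head_cons] <;> norm_num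
  have h0 := norm_nonneg (latPt 1 hexFrame m + hcpShift)
  nlinarith

/-- A-layer neighbours of a B-site: `m ∈ nnShiftNeg → ‖P (−m) + hcpShift‖ = 1`. [arithmetic] -/
theorem norm_hexPt_neg_add_shift_of_mem_nnShiftNeg {m : Fin 3 → ℤ} (hm : m ∈ nnShiftNeg) : ‖latPt 1 hexFrame (-m) + hcpShift‖ = 1 := by
  have hsq : ‖latPt 1 hexFrame (-m) + hcpShift‖ ^ 2 = 1 := by
    rw [norm_sq_hexPt_add_shift]
    simp only [nnShiftNeg, Finset.mem_insert, Finset.mem_singleton] at hm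
    rcases hm with rfl | rfl | rfl | rfl | rfl | rfl <;> simp [Matrix.cons_val_two, Matrix.tail_cons, Matrix.head_cons] <;> norm_num
  have h0 := norm_nonneg (latPt 1 hexFrame (-m) + hcpShift)
  nlinarith

/-- The relative position of the site labelled `(β, a)`: `latPt G hexFrame a`, plus `G (hcpShift + ξ)` on the shifted layer family `β = true`. -/
noncomputable def hcpPos (G : E3 →L[ℝ] E3) (ξ : E3) (L : Bool × (Fin 3 → ℤ)) : E3 := latPt G hexFrame L.2 + if L.1 = true then G (hcpShift + ξ) else 0

/-- The twelve neighbour labels of `(β, a)`: six in its own family, six in the other (`nnShift` above an unshifted site, `nnShiftNeg` above a shifted one). -/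
def hcpNbrs (L : Bool × (Fin 3 → ℤ)) : Finset (Bool × (Fin 3 → ℤ)) :=
  (nnHex.image fun m => (L.1, L.2 + m)) ∪ ((if L.1 = true then nnShiftNeg else nnShift).image fun m => (!L.1, L.2 + m))

/-- `hcpPos` is injective (`latPt_hex_injective` within a family, `shifted_ne_unshifted` across). [folklore] -/
theorem hcpPos_injective {G : E3 →L[ℝ] E3} (hG : ‖G - 1‖ ≤ 1 / 4) {ξ : E3} (hξ : ‖ξ‖ ≤ 1 / 4) : Function.Injective (hcpPos G ξ) := by
  rintro ⟨β, a⟩ ⟨β', a'⟩ h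
  cases β <;> cases β' <;> simp only [hcpPos, Bool.false_eq_true, if_false, if_true, add_zero] at h
  · rw [latPt_hex_injective hG h]
  · exact absurd h.symm (shifted_ne_unshifted hG hξ a' a)
  · exact absurd h (shifted_ne_unshifted hG hξ a a')
  · rw [latPt_hex_injective hG (add_right_cancel h)]

/-- `#hcpNbrs L = 12`. [arithmetic] -/
theorem card_hcpNbrs (L : Bool × (Fin 3 → ℤ)) : (hcpNbrs L).card = 12 := by
  obtain ⟨hA, -, hB, hBn⟩ := card_nn6
  have h6 : (if L.1 = true then nnShiftNeg else nnShift).card = 6 := by split_ifs <;> assumption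
  rw [hcpNbrs, Finset.card_union_of_disjoint, Finset.card_image_of_injective _ (fun m m' h => by simpa using h),
    Finset.card_image_of_injective _ (fun m m' h => by simpa using h), hA, h6]
  refine Finset.disjoint_left.2 fun K h1 h2 => ?_
  obtain ⟨m, -, rfl⟩ := Finset.mem_image.1 h1
  obtain ⟨m', -, h'⟩ := Finset.mem_image.1 h2
  have := (Prod.mk.inj h').1
  cases hL : L.1 <;> simp [hL] at this

/-- ★ Neighbour offsets are short: `L' ∈ hcpNbrs L → ‖hcpPos L' − hcpPos L‖ ≤ 25/16` (`(5/4)·‖P m‖` resp. `(5/4)·(‖P m ± hcpShift‖ + ‖ξ‖)`). [folklore] -/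
theorem norm_hcpPos_sub_le {G : E3 →L[ℝ] E3} (hG : ‖G - 1‖ ≤ 1 / 4) {ξ : E3} (hξ : ‖ξ‖ ≤ 1 / 4) (L : Bool × (Fin 3 → ℤ))
    {L' : Bool × (Fin 3 → ℤ)} (h : L' ∈ hcpNbrs L) : ‖hcpPos G ξ L' - hcpPos G ξ L‖ ≤ 25 / 16 := by
  obtain ⟨β, a⟩ := L
  rcases Finset.mem_union.1 h with h | h
  · obtain ⟨m, hm, rfl⟩ := Finset.mem_image.1 h
    have e : hcpPos G ξ (β, a + m) - hcpPos G ξ (β, a) = G (latPt 1 hexFrame m) := by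
      simp only [hcpPos, latPt_add, ← latPt_eq_apply_one]; abel
    rw [e]
    have := norm_apply_le_of_near_one hG (latPt 1 hexFrame m)
    rw [norm_hexPt_of_mem_nnHex hm] at this
    linarith
  · obtain ⟨m, hm, rfl⟩ := Finset.mem_image.1 h
    cases β
    · simp only [Bool.false_eq_true, if_false] at hm
      have e : hcpPos G ξ (!false, a + m) - hcpPos G ξ (false, a) = G (latPt 1 hexFrame m + hcpShift + ξ) := by
        simp only [hcpPos, Bool.not_false, if_true, Bool.false_eq_true, if_false, latPt_add, add_zero, ← shifted_eq_apply]; abel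
      rw [e]
      have h1 := norm_apply_le_of_near_one hG (latPt 1 hexFrame m + hcpShift + ξ)
      have h2 : ‖latPt 1 hexFrame m + hcpShift + ξ‖ ≤ 1 + 1 / 4 :=
        (norm_add_le _ _).trans (by rw [norm_hexPt_add_shift_of_mem_nnShift hm]; linarith)
      linarith
    · simp only [if_true] at hm
      have e : hcpPos G ξ (!true, a + m) - hcpPos G ξ (true, a) = -G (latPt 1 hexFrame (-m) + hcpShift + ξ) := by
        rw [← shifted_eq_apply, latPt_neg]
        simp only [hcpPos, Bool.not_true, Bool.false_eq_true, if_false, if_true, latPt_add, add_zero]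
        abel
      rw [e, norm_neg]
      have h1 := norm_apply_le_of_near_one hG (latPt 1 hexFrame (-m) + hcpShift + ξ)
      have h2 : ‖latPt 1 hexFrame (-m) + hcpShift + ξ‖ ≤ 1 + 1 / 4 :=
        (norm_add_le _ _).trans (by rw [norm_hexPt_neg_add_shift_of_mem_nnShiftNeg hm]; linarith)
      linarith

end Summit.AtomisticToContinuum.Crystallization.Theorems.FrustratedLawDichotomyStrainedPatchTaylorLattice
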